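import Summits.ValiantsHypothesis.ValiantsHypothesis.Theorems.BinomialElusivePeelingLemmaArmRigid

/-!
# §3g STEP 4 (the case `a ≡ 0`): a lone antisymmetric arm cannot hide all its readings but the top

Helper for the crux stmt-ValiantsHypothesis-7391 (negative lane; `Cruxes/PeelingLemma/DETERMINISTIC-ALLX.md`
§3g STEP 4 / §3h (E5)).  When every edge total `a = u+v` vanishes, `S² = -S¹` and `S¹ = S⁻/2` is the
vertex-charge combination of `g t = d t - d (t-1)`; the top private letter of an arm with `d ≢ 0`
always reads `g (T+1) = -d T ≠ 0` (`T` = last loaded edge).  This file shows that the OTHER readings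
cannot all vanish: if the `b`-letters read `d 0 + P s = 0` for all `s ≤ 2q` and the private letters
born at `t₀ ≤ T`, read zero, then `d T = 0` (`top_rigid`) — so a lone active antisymmetric arm has
at least two support letters on each side.  Pointwise hypotheses; no windows; no Theses import.
-/

namespace Summit.ValiantsHypothesis.ValiantsHypothesis.Theorems.PeelingLemmaRigidity

-- summit = sub-problem name (single-conjunct summit, D-0017 layout), so the namespace repeats it
set_option linter.dupNamespace false

open scoped BigOperators
open Finset

/-- **STEP 4 rigidity.**  See the file header. -/
theorem top_rigid {q T : ℕ} (hq : 1 ≤ q) (d : ℕ → ℤ) (habove : ∀ t, T < t → d t = 0)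
    (hbeta : ∀ s, s ≤ 2 * q → d 0 + ∑ t ∈ Finset.Icc 1 s, (-1 : ℤ) ^ t * (d t - d (t - 1)) = 0)
    (hread : ∀ t₀, 1 ≤ t₀ → t₀ ≤ T →
      ∑ t ∈ Finset.Icc t₀ (t₀ + 2 * q), (-1 : ℤ) ^ (t - t₀) * (d t - d (t - 1)) = 0) :
    d T = 0 := by
  set P : ℕ → ℤ := fun s => ∑ t ∈ Finset.Icc 1 s, (-1 : ℤ) ^ t * (d t - d (t - 1)) with hPdef
  have hPg : ∀ t, 1 ≤ t → P t - P (t - 1) = (-1) ^ t * (d t - d (t - 1)) := fun t ht => prefix_succ d t ht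
  -- d 0 = 0 (reading of the oldest letter, s = 0) and P ≡ 0 on [0, 2q]
  have hd0 : d 0 = 0 := by have := hbeta 0 (by omega); simpa [hPdef] using this
  have hlow : ∀ s, s ≤ 2 * q → P s = 0 := fun s hs => by
    have := hbeta s hs; rw [hd0, zero_add] at this; exact this
  -- P n = 0 for all n ≤ T + 1, by strong induction (one period down lands below T)
  have hall : ∀ n, n ≤ T + 1 → P n = 0 := by
    intro n
    induction n using Nat.strong_induction_on with
    | _ n ih =>
      intro hn
      by_cases hs : n ≤ 2 * q
      · exact hlow n hs
      · -- n = s + (2q+1) with s + 1 ≤ T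
        have hper := periodic_of_window_zero (g := fun t => d t - d (t - 1)) hPg q (n - (2 * q + 1))
          (hread (n - (2 * q + 1) + 1) (by omega) (by omega))
        rw [show n - (2 * q + 1) + (2 * q + 1) = n by omega] at hper
        rw [hper]
        exact ih _ (by omega) (by omega)
  -- hence g (T+1) = 0, i.e. d T = d (T+1) = 0
  have h1 := hPg (T + 1) (by omega)
  rw [Nat.add_sub_cancel, hall (T + 1) le_rfl, hall T (by omega), sub_self, habove (T + 1) (by omega),
    zero_sub] at h1
  have hne : ((-1 : ℤ) ^ (T + 1)) ≠ 0 := pow_ne_zero _ (by norm_num)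
  have : -d T = 0 := by
    rcases mul_eq_zero.mp h1.symm with h | h
    · exact absurd h hne
    · exact h
  linarith

end Summit.ValiantsHypothesis.ValiantsHypothesis.Theorems.PeelingLemmaRigidity
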